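import Literature.ModelTheory.PseudofiniteFields.EtaleOpenTopologyBasis

/-!
# Stub B of line LonelyTranslates: basis properties of standard étale images

Crux `PairwiseCurvedTilingsLC` (route DefinableSTPPDichotomy, stmt-MatrixMultiplication-17883),
negative line LonelyTranslates.  The registered stub `stub_etale_basis` packages three elementary
facts on images of standard étale data over a field `K`, proved in
`Literature/ModelTheory/PseudofiniteFields/EtaleOpenTopologyBasis.lean`: principal opens `{f ≠ 0}`
are étale images, and étale images are stable under translation and under pairwise
intersection.  It is consumed (as the hypothesis `hbasis`) by `stub_noLonelyInterior`.
-/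

set_option linter.dupNamespace false  -- `Summit.<S>.<S>.…` is the mandated namespace

namespace Summit.MatrixMultiplication.MatrixMultiplication.Theorems.PairwiseCurvedTilingsLC.Negative

open Literature.ModelTheory.PseudofiniteFields

/-- STUB B (étale-open basis): over a field, principal opens are étale images
(`EtaleDatum.exists_image_eq_setOf_eval_ne_zero`, Rabinowitsch datum `T · f − 1`), and étale
images are stable under translation (`EtaleDatum.exists_image_eq_translate`, substitution
`X ↦ X + v`) and under pairwise intersection (`EtaleDatum.exists_image_eq_inter`, concatenated
datum with block-diagonal Jacobian). -/
theorem stub_etale_basis (K : Type) [Field K] (m : ℕ) :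
    (∀ f : MvPolynomial (Fin m) K, ∃ D : EtaleDatum K m 1,
        D.image = {x | MvPolynomial.eval x f ≠ 0}) ∧
    (∀ (r : ℕ) (D : EtaleDatum K m r) (v : Fin m → K), ∃ D' : EtaleDatum K m r,
        D'.image = {x | x + v ∈ D.image}) ∧
    (∀ (r₁ r₂ : ℕ) (D₁ : EtaleDatum K m r₁) (D₂ : EtaleDatum K m r₂),
        ∃ D : EtaleDatum K m (r₁ + r₂), D.image = D₁.image ∩ D₂.image) :=
  ⟨EtaleDatum.exists_image_eq_setOf_eval_ne_zero, fun _ D v => D.exists_image_eq_translate v,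
    fun _ _ D₁ D₂ => D₁.exists_image_eq_inter D₂⟩

end Summit.MatrixMultiplication.MatrixMultiplication.Theorems.PairwiseCurvedTilingsLC.Negative
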